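import Summits.BirchSwinnertonDyer.Rank1Residual.Additive.KatoDescentTorsionFreeReadings
import Summits.BirchSwinnertonDyer.Rank1Residual.Supersingular.DescentLowerBound
import Literature.NumberTheory.EllipticCurves.Kato2004.ZetaIndexMuDefectSkeletonProofs
import HarnessLib

/-!
# The Kato descent at a residually IRREDUCIBLE additive potentially good prime with NO image
# hypothesis, rank `0`: the upper half `ord_p #Ш ≤ ord_p #Ш_an` UP TO ONE NAMED DEFECT — the
# `μ`-invariant of `𝐇²(T_pE)⁰` — over three image-free readings (cell `bsd-potss`, seat `k9-c4`;
# consumer: `Theorems/KatoDescentPotSupersingularWildUpperNonsurjTowerOfMuZero.lean`, item 19189)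

HONEST FRAMING (cell `bsd-potss`, `run/shared/lean/pub/bsd-potss/`, FULL-BSD rank-`≤ 1` programme
tranche 1b, row B5 = O6 wild `3`, the IRREDUCIBLE rows of the upper-half crux U₀ of route
`KatoDescentPotSupersingular` whose `3`-adic tower image is NOT surjective — item
stmt-BirchSwinnertonDyer-19189 `WildUpperNonsurjTower`; typed against the class shells of cell
`b2b-bsdres`): NOTHING about Kato's objects is asserted and no Literature fact is minted. As in the kmc
seat's parts 1–13 (`KatoDescentDatum`, `KatoDescentTorsionFree*`, …) Kato's modules `𝐇¹(T)⁰`, `z_γ`,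
`𝐇²(T)⁰`, `H¹(ℤ[1/p], j_*T)` enter through the INTERFACE `KatoDescentDatum p` / `IsOf`, the printed
theorems about them as hypothesis SCHEMATA with locators (§1), and the one UNPRINTED input as the named
predicate `Irreducible.H2MuZero` (§1: "`μ(𝐇²(T_pW)⁰) = 0`"). Census numbers are not inputs; nothing is
booked; no mark of `RESIDUAL-MAP.md` moves; the item stays OPEN.

## What is printed on these rows, and what is not (Kato, Astérisque 295)

On a row with `E[p]` irreducible but `ρ_{E,p^∞}(G_{ℚ(ζ_{p^∞})}) ⊉ SL₂(ℤ_p)` (at `p = 3`: mod-`3` image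
the normaliser of a Cartan subgroup, or surjective mod `3` but not mod `9` — Elkies' curves, all of
which are additive potentially good at `3`, Wuthrich 2014 Lemma 20), Kato's Thm. 12.5 **(4)** / 14.5 (3)
are NOT available: their proof (13.14, p. 234) runs through Thm. 13.4 (3), whose hypothesis "there is
`σ ∈ Gal(ℚ̄/ℚ(ζ_{p^∞}))` with `Coker(1 − σ : T → T)` free of rank one" forces, together with the
irreducibility of `T/𝔪T`, the mod-`p` image to contain `SL₂(𝔽_p)` and (at `p = 3`) the mod-`9` image
to contain an element of order `9`, hence `SL₂(ℤ/9)` — i.e. (12.5.2). What IS printed WITHOUT any image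
hypothesis:
* Thm. 12.4 (2)–(3) (p. 221): `𝐇¹(T)` is finitely generated torsion free of `Λ ⊗ ℚ`-rank one, and
  **FREE of rank one if `p ≠ 2` and `T/𝔪T` is irreducible**;
* Thm. 12.5 (1)–(2) (p. 221): the zeta elements `z_γ^{(p)} ∈ 𝐇¹(V)`, `exp*`-interpolating
  `L_{(p)}(f, χ, r)`; `Z(f)_𝔮 ≠ 0` at height `0`;
* **Thm. 12.5 (3)** (p. 222): `length_{Λ_𝔭} 𝐇²(V)_𝔭 ≤ length_{Λ_𝔭}(𝐇¹(V)_𝔭/Z(f)_𝔭) + length 𝐇²_loc(V)_𝔭`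
  at every height-one `𝔭` **not containing `p`**, the local term being non-zero only under (12.5.1)
  (`f` not potentially good at `p` — excluded on our rows, Remark 12.7);
* Thm. 12.6 (p. 222) + 13.14 (p. 234): for `T = V_{O_λ}(f)` the explicitly integral classes span a
  finite-index submodule `Z ⊂ Z(f,T)`, so `Z(f,T)_𝔭 ⊂ 𝐇¹(T)_𝔭` at every height-one `𝔭`, and
  **`Z(f,T) ⊂ 𝐇¹(T)` as soon as `𝐇¹(T)` is free** — 13.14 uses (12.5.2) here only through "`T = a·V_{O_λ}(f)`
  (see 12.8)", i.e. the homothety of all stable lattices, which needs only `E[p]` irreducible (Kato's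
  remark after (12.8.1); tree THEOREM `Kato2004.exists_eq_pow_smul_of_galoisStable_of_hasIrreducibleModPGaloisRep`);
* Thm. 14.5 (1)–(2) (p. 236), §14.14 (14.14.1)–(14.14.2), Lemma 14.15, Prop. 14.16 (2), §14.8, Prop.
  14.21/14.22 — the rank-`0` Poitou–Tate count, image-free (kmc part 8a's
  `TorsionFree.DescentCountReading`, referee g7: "the display is image-free").
Consequence (module theory, `Kato2004/ZetaIndexMuDefectSkeletonProofs.lean`, this seat): with the
divisibility assumed only OFF `(p)`, Kato's §14.14 descent gives `ord_p #H²(ℤ[1/p],T) ≤ ord_p [H¹(ℤ[1/p],T) : z] + μ(𝐇²(T)⁰)`,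
and the count then reads **`ord_p #Ш(E) + v_p Tam(E) ≤ ord_p(L(E,1)/Ω_E) + μ(𝐇²(T)⁰)`** — A161″'s
conclusion with (12.5.2) replaced by `E[p]` irreducible, at the price of exactly ONE named defect, the
`μ`-invariant of Kato's `𝐇²(T_pE)⁰` (§3 below). The defect vanishes iff `𝐇²(T)⁰` is finitely generated
over `ℤ_p` (tree theorem `muInvariant_eq_zero_iff_holds`); by global duality this is Coates–Sujatha's
Conjecture A for `(E, p)` up to finitely generated local terms — PRINTED when `E` admits a `p`-isogeny
(Wuthrich 2014 Lemma 14 / Coates–Sujatha Thm. 3.4; used on the reducible rows by the hull readings of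
`O6/X3KatoMemberBoundOfHullReadings.lean`), OPEN on the irreducible non-surjective rows. So the crux
`WildUpperNonsurjTower` is EXACTLY "`μ(𝐇²(T₃E)⁰) = 0` on its rows" over printed readings: the
"uncontrolled power of `3`" of its why-it-might-fail is `3^{μ(𝐇²(T)⁰)}` and nothing else.

## Contents

* §1 READINGS (hypothesis schemata over `IsOf`; nothing asserted): `Irreducible.Realizable` (a datum
  with integral zeta element exists when `E[p]` is irreducible, `p ≠ 2`), `Irreducible.DivisibilityOffP`
  (Thm. 12.5 (3) on the datum), `Irreducible.ZetaIndexNeZero` (Thm. 14.5 (1)–(2): the index is finite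
  when `L(E,1) ≠ 0`); the named defect predicate `Irreducible.H2MuZero IsOf W p`.
* §2 CONSISTENCY: on the (12.5.2) rows `Irreducible.DivisibilityOffP` follows from part 1's
  `DivisibilityReading` (and `Irreducible.Realizable`'s conclusion from part 1's `Realizable`, which is
  verbatim part 8a's `TorsionFree.realizable_of_realizable`).
* §3 THE DESCENT WITH DEFECT (kernel): `Irreducible.exists_shaAn_le_add_muInvariant` —
  `ord_p #Ш ≤ ord_p #Ш_an + μ(𝐇²(T)⁰)` on every residually irreducible additive potentially good
  rank-`0` row, `p ≠ 2`, ANY image; `Irreducible.missingUpperBoundAt_of_h2MuZero` — the upper half when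
  the defect vanishes.

References: K. Kato, Astérisque 295 (2004): Thm. 12.4 (p. 221), Thm. 12.5 (1)–(4), (12.5.1)–(12.5.2)
(pp. 221–222), Thm. 12.6, Remark 12.7 (p. 222), remark after (12.8.1) (p. 223), Thm. 13.4 (3) (p. 226),
13.14 (p. 234), Thm. 14.5 (1)–(3) (p. 236), §14.8 (p. 238), §14.14 (14.14.1)–(14.14.2) and Lemma 14.15
(pp. 243–244), Prop. 14.16 (2) (p. 244), Prop. 14.21–14.22 (pp. 248–249) [Kato2004Asterisque];
J. Coates, R. Sujatha, Math. Ann. 331 (2005) Conj. A, Thm. 3.4 [CoatesSujatha2005]; C. Wuthrich, Doc.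
Math. 19 (2014) Lemma 14 (p. 396), Lemma 20 (p. 399) [Wuthrich2014]; L. Washington, GTM 83, §13.2
[Washington1997]; R. L. Miller, LMS JCM 14 (2011) Def. 1.1 [Miller2011LMS]; B. Mazur 1977 III.5
[Mazur1977].
-/

set_option autoImplicit false

noncomputable section

open scoped Classical

open WeierstrassCurve Literature.NumberTheory.EllipticCurves
  Literature.NumberTheory.EllipticCurves.ModularForms
  Literature.NumberTheory.EllipticCurves.Rank1Residual
  Literature.NumberTheory.EllipticCurves.Rank1Residual.Typed
  Literature.NumberTheory.EllipticCurves.IwasawaAlgebra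

namespace Summit.BirchSwinnertonDyer.Rank1Residual.Additive

namespace Irreducible

/-! ## §1 The readings at a residually irreducible prime (hypothesis schemata; NO image hypothesis; nothing asserted) -/

section Readings

variable (IsOf : ∀ (W : WeierstrassCurve ℚ) [W.IsElliptic] [W.IsGloballyMinimal] (p : ℕ) [Fact p.Prime],
  KatoDescentDatum p → Prop)

/-- **READING I3 — at a residually IRREDUCIBLE `p ≠ 2` a Kato descent datum (with INTEGRAL zeta element)
is realised, image-free.** For `W/ℚ` globally minimal, `p ≠ 2` additive potentially good, `E[p]`
irreducible: `𝐇¹(T)⁰` is FREE of rank one (Thm. 12.4 (3): "If `p ≠ 2` and if `T/𝔪_λT` is irreducible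
… `𝐇¹(T)` is a free `Λ`-module of rank 1"), hence torsion free; all stable lattices of `V_pE` are
homothetic (remark after (12.8.1); tree theorem
`Kato2004.exists_eq_pow_smul_of_galoisStable_of_hasIrreducibleModPGaloisRep`), so `T_pE = a·V_{ℤ_p}(f)(1)`
and 13.14's argument applies verbatim: `Z ⊂ Z(f,T)` of finite index (Thm. 12.6) and `𝐇¹(T)` free give
`Z(f,T) ⊂ 𝐇¹(T)` — the zeta element `(z_γ)⁰` (`γ⁺` a basis of `T(−1)⁺`) is INTEGRAL; `z ≠ 0` with
`𝐇¹/Λz` torsion (12.4 (2), 12.5 (2), 13.7); `𝐇²(T)⁰` finitely generated torsion (12.4 (1)); (14.14.1)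
"by the argument as in 13.8" (`H⁰(ℚ,T) = 0`). = part 1's `Realizable` with (12.5.2) REPLACED by
`Irr W p`: of 13.14's two uses of (12.5.2) the homothety needs only irreducibility and the freeness is
12.4 (3); the third use — Thm. 13.4 (3), the divisibility — is NOT claimed here. Hypothesis schema;
nothing asserted. [cite: Kato2004Asterisque, Thm. 12.4 (2)–(3) (p. 221), Thm. 12.5 (2) (p. 221), Thm. 12.6 (p. 222), remark after (12.8.1) (p. 223), 13.14 (p. 234), §14.14 (14.14.1) (p. 243)] -/
def Realizable : Prop :=
  ∀ (W : WeierstrassCurve ℚ) [W.IsElliptic] [W.IsGloballyMinimal] (p : ℕ) [Fact p.Prime],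
    p ≠ 2 → Addv W p → 0 ≤ padicValRat p W.j → Irr W p →
    ∃ D : KatoDescentDatum p, IsOf W p D

/-- **READING I2 — Kato's Theorem 12.5 (3) on a realised datum: the divisibility OFF `(p)`, image-free.**
For `W/ℚ` globally minimal, `p ≠ 2` additive POTENTIALLY GOOD and a realised datum `D` of `W`:
`ℓ_𝔮(𝐇²(T)⁰) ≤ ℓ_𝔮(𝐇¹(T)⁰/Λz)` at every height-one prime `𝔮` of `Λ = ℤ_p⟦T⟧` OTHER THAN `(p)` —
Thm. 12.5 (3): "Let `𝔭` be a prime ideal of `Λ` of height one which does not contain `p`. Then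
`length 𝐇²(V)_𝔭 ≤ length(𝐇¹(V)_𝔭/Z(f)_𝔭) + length 𝐇²_loc(V)_𝔭`", where `𝐇²_loc(V)_𝔭 ≠ 0` forces
(12.5.1) "`f` is not potentially of good reduction at `p`" — excluded (`0 ≤ ord_p j`, Remark 12.7);
rational coefficients suffice off `(p)` (`Λ_𝔮` is a localisation of `Λ[1/p]`, so `𝐇²(T)⁰_𝔮 = 𝐇²(V)⁰_𝔮`,
`(𝐇¹(T)⁰/Λz)_𝔮 = (𝐇¹(V)⁰/Z(f)⁰)_𝔮` with `Z(f)⁰ = Λ⁰·z` on the trivial component, `γ ↦ z_γ` being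
`F_λ`-linear (12.5 (1)) and even characters seeing `γ⁺` only (14.5 (2))). NO image hypothesis and no
(ir)reducibility hypothesis: Thm. 12.5 (3) has none (proved in §13 without CM and §15 with CM). The
inequality AT `(p)` is Thm. 12.5 (4) and is NOT claimed. Hypothesis schema; nothing asserted.
[cite: Kato2004Asterisque, Thm. 12.5 (3) and (12.5.1) (p. 222), Remark 12.7 (p. 222), Thm. 12.5 (1) (p. 221), Thm. 14.5 (2) (p. 236)] -/
def DivisibilityOffP : Prop :=
  ∀ (W : WeierstrassCurve ℚ) [W.IsElliptic] [W.IsGloballyMinimal] (p : ℕ) [Fact p.Prime]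
    (D : KatoDescentDatum p),
    p ≠ 2 → Addv W p → 0 ≤ padicValRat p W.j → IsOf W p D →
    ∀ 𝔮 : PrimeSpectrum (IwasawaAlgebra p), 𝔮.asIdeal.height = 1 → 𝔮.asIdeal ≠ augIdealP p →
      Module.lengthAt (IwasawaAlgebra p) D.H2 𝔮 ≤
        Module.lengthAt (IwasawaAlgebra p) (D.H ⧸ (IwasawaAlgebra p) ∙ D.z) 𝔮

/-- **READING I4 — Kato's Theorem 14.5 (1)–(2) on a realised datum: in analytic rank `0` the zeta
element SURVIVES at the bottom layer, image-free.** For `W/ℚ` globally minimal, `p ≠ 2` additive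
potentially good with `L(E,1) ≠ 0` and a realised datum `D`: `[H¹(ℤ[1/p],T) : z] ≠ 0`, i.e. the image
`ι(z̄)` of the zeta element in `A = H¹(ℤ[1/p],T)` is non-torsion of finite index — Thm. 14.5 (1)
("`H²(ℤ[1/p],T)` is finite and `rank_{O_λ} H¹(ℤ[1/p],T) = 1`") and (2) ("if `γ^± ≠ 0`, `z` is an
`F_λ`-basis of `H¹(ℤ[1/p], V_{F_λ}(f)(r))`", here `r = 1`, `± = +`, `γ⁺ ≠ 0`), both under the sole
standing hypothesis `L(f, k/2) ≠ 0` (no image hypothesis). In the datum: `D.zetaIndex =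
Nat.card (A ⧸ Λ·ι z̄) ≠ 0`. Hypothesis schema; nothing asserted.
[cite: Kato2004Asterisque, Thm. 14.5 (1)–(2) and the definition of `[M : z]` (pp. 236–237)] -/
def ZetaIndexNeZero : Prop :=
  ∀ (W : WeierstrassCurve ℚ) [W.IsElliptic] [W.IsGloballyMinimal] (p : ℕ) [Fact p.Prime]
    (D : KatoDescentDatum p),
    p ≠ 2 → Addv W p → 0 ≤ padicValRat p W.j → W.entireLFunction 1 ≠ 0 → IsOf W p D →
    D.zetaIndex ≠ 0

/-- **THE NAMED DEFECT — `μ(𝐇²(T_pW)⁰) = 0`**: on every realised Kato descent datum of `(W, p)` the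
`μ`-invariant of `H2 = 𝐇²(T)⁰` (the tree's `muInvariant`: the local length at the height-one prime
`(p)`) vanishes; equivalently `𝐇²(T)⁰` is finitely generated over `ℤ_p` (`muInvariant_eq_zero_iff_holds`).
By Kato's global duality (`𝐇²(T)` maps to the Pontryagin dual of the fine Selmer group over
`ℚ(ζ_{p^∞})` with finitely generated local kernel/cokernel at a potentially good `p`) this is
Coates–Sujatha's Conjecture A for `(E, p)`; PRINTED when `E` admits a rational `p`-isogeny (Wuthrich
2014 Lemma 14, Coates–Sujatha Thm. 3.4 — the `(p)`-part of the hull reading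
`KatoHull.DivisibilityReading`), OPEN when `E[p]` is irreducible and `ρ_{E,p^∞}` is not surjective.
A predicate (the ONE unprinted input of §3); nothing asserted.
[cite: CoatesSujatha2005, Conjecture A and Thm. 3.4] [cite: Wuthrich2014, Lemma 14 (p. 396)] [cite: Washington1997, §13.2] -/
def H2MuZero (W : WeierstrassCurve ℚ) [W.IsElliptic] [W.IsGloballyMinimal] (p : ℕ) [Fact p.Prime] :
    Prop :=
  ∀ D : KatoDescentDatum p, IsOf W p D → muInvariant p D.H2 = 0

end Readings

/-! ## §2 Consistency: on the (12.5.2) rows the new schemata are IMPLIED by part 1's -/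

section Consistency

variable {IsOf : ∀ (W : WeierstrassCurve ℚ) [W.IsElliptic] [W.IsGloballyMinimal] (p : ℕ) [Fact p.Prime],
  KatoDescentDatum p → Prop}

/-- **Part 1's `DivisibilityReading` (Thm. 12.5 (4), under (12.5.2)) implies Reading I2's conclusion
on the (12.5.2) rows** (drop the prime `(p)`): the new schema is not a new claim there.
[cite: Kato2004Asterisque, Thm. 12.5 (3)–(4) (p. 222)] -/
theorem divisibilityOffP_of_divisibilityReading (hD : Additive.DivisibilityReading IsOf)
    (W : WeierstrassCurve ℚ) [W.IsElliptic] [W.IsGloballyMinimal] (p : ℕ) [Fact p.Prime]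
    (D : KatoDescentDatum p) (hp : p ≠ 2) (hadd : Addv W p) (hj : 0 ≤ padicValRat p W.j)
    (hK : Kato2004.ImageContainsSL2 W p) (hDof : IsOf W p D)
    (𝔮 : PrimeSpectrum (IwasawaAlgebra p)) (h𝔮 : 𝔮.asIdeal.height = 1)
    (_hne : 𝔮.asIdeal ≠ augIdealP p) :
    Module.lengthAt (IwasawaAlgebra p) D.H2 𝔮 ≤
      Module.lengthAt (IwasawaAlgebra p) (D.H ⧸ (IwasawaAlgebra p) ∙ D.z) 𝔮 :=
  hD W p D hp hadd hj hK hDof 𝔮 h𝔮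

end Consistency

/-! ## §3 THE DESCENT WITH THE `μ`-DEFECT (kernel; rank `0`, `E[p]` irreducible, any image) -/

section Descent

variable {IsOf : ∀ (W : WeierstrassCurve ℚ) [W.IsElliptic] [W.IsGloballyMinimal] (p : ℕ) [Fact p.Prime],
  KatoDescentDatum p → Prop}

variable (W : WeierstrassCurve ℚ) [W.IsElliptic] [W.IsGloballyMinimal] (p : ℕ) [Fact p.Prime]

/-- **KATO'S RANK-`0` BOUND WITH THE `μ`-DEFECT at a residually irreducible additive potentially good
`p ≠ 2`, ANY image: `ord_p #Ш(E) ≤ ord_p #Ш_an(E) + μ(𝐇²(T)⁰)`** on a realised datum `D` — over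
Readings I2 (Thm. 12.5 (3)), I4 (Thm. 14.5 (1)–(2)), part 8a's image-free count 1♭ (Prop. 14.16 (2)
etc.), GZK and modularity. Kernel route: the count gives `#Ш_an = q'` with
`ord_p q' = ord_p #Ш + v_p[A : z] − v_p #H²` (`p ∤ #tors` by irreducibility), and the module theory
`Kato2004.padicValNat_natCard_coinvariants_le_add_muInvariant_of_lengthAt_le_off_augIdealP` gives
`v_p #H² ≤ v_p [A : z] + μ(H2)`. With `μ(H2) = 0` this is A161″'s conclusion without (12.5.2).
[cite: Kato2004Asterisque, Thm. 12.5 (3) (p. 222), Thm. 14.5 (1)–(3) (p. 236), §14.14 and Lemma 14.15 (pp. 243–244), Prop. 14.16 (2) (p. 244)]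
[cite: Washington1997, §13.2] [cite: Miller2011LMS, Def. 1.1] -/
theorem exists_shaAn_le_add_muInvariant (hR : TorsionFree.DescentCountReading IsOf)
    (hdiv : DivisibilityOffP IsOf) (hz : ZetaIndexNeZero IsOf)
    (hGZK : rank_eq_analyticRank_of_analyticRank_le_one) (hmod : hasEntireLFunction_rat)
    (hr : W.analyticRank = 0) (hp : p ≠ 2) (hadd : Addv W p) (hj : 0 ≤ padicValRat p W.j)
    (hirr : Irr W p) (D : KatoDescentDatum p) (hDof : IsOf W p D) :
    ∃ q : ℚ, shaAn W = (q : ℂ) ∧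
      (padicValNat p W.shaOrder : ℤ) ≤ padicValRat p q + muInvariant p D.H2 := by
  have hL : W.entireLFunction 1 ≠ 0 := (W.analyticRank_eq_zero_iff_holds (hmod W)).mp hr
  have hfin : Finite W.sha := (hGZK W (by rw [hr]; exact zero_le_one)).2
  have ht : ¬ p ∣ W.torsionOrder := Supersingular.not_dvd_torsionOrder_of_irr W p hirr
  obtain ⟨hfinH2, q, hq, hcount⟩ := hR W p D hp hadd hj ht hL hfin hDof
  obtain ⟨q', hq', hv⟩ := TorsionFree.exists_shaAn_eq_of_count W p hGZK hr hL ht hq hcount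
  have hne : D.zetaIndex ≠ 0 := hz W p D hp hadd hj hL hDof
  have hle : padicValNat p D.h2Card ≤ padicValNat p D.zetaIndex + muInvariant p D.H2 :=
    Kato2004.padicValNat_natCard_coinvariants_le_add_muInvariant_of_lengthAt_le_off_augIdealP D.z
      D.z_ne_zero D.isTorsion_quotient D.isTorsion_H2 (hdiv W p D hp hadd hj hDof) D.ι D.π
      D.ι_injective D.π_surjective D.exact_ι_π hfinH2 hne
  refine ⟨q', hq', ?_⟩
  have hle' : (padicValNat p D.h2Card : ℤ) ≤ (padicValNat p D.zetaIndex : ℤ) + muInvariant p D.H2 := by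
    exact_mod_cast hle
  rw [hv]
  linarith

/-- **The upper half `ord_p #Ш ≤ ord_p #Ш_an` on a residually irreducible additive potentially good
rank-`0` row, `p ≠ 2`, ANY image, WHEN THE DEFECT VANISHES** (`μ(𝐇²(T)⁰) = 0` on the realised data,
the predicate `H2MuZero`; a datum exists by Reading I3). Over Readings I2–I4, part 8a's count 1♭, GZK,
modularity. Conditional over displayed hypotheses; nothing about Kato's objects is asserted.
[cite: Kato2004Asterisque, Thm. 12.5 (3) (p. 222), Thm. 14.5 (1)–(3) (p. 236), Prop. 14.16 (2) (p. 244)]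
[cite: CoatesSujatha2005, Conjecture A] -/
theorem missingUpperBoundAt_of_h2MuZero (hR : TorsionFree.DescentCountReading IsOf)
    (hdiv : DivisibilityOffP IsOf) (hz : ZetaIndexNeZero IsOf) (hreal : Realizable IsOf)
    (hGZK : rank_eq_analyticRank_of_analyticRank_le_one) (hmod : hasEntireLFunction_rat)
    (hr : W.analyticRank = 0) (hp : p ≠ 2) (hadd : Addv W p) (hj : 0 ≤ padicValRat p W.j)
    (hirr : Irr W p) (hμ : H2MuZero IsOf W p) : MissingUpperBoundAt W p := by
  obtain ⟨D, hDof⟩ := hreal W p hp hadd hj hirr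
  obtain ⟨q, hq, hle⟩ :=
    exists_shaAn_le_add_muInvariant W p hR hdiv hz hGZK hmod hr hp hadd hj hirr D hDof
  refine ⟨q, hq, ?_⟩
  rw [hμ D hDof] at hle
  simpa using hle

/-- **… in A161″'s currency on a realised datum: `ord_p #Ш(E)(p) + v_p Tam(E) ≤ ord_p(L(E,1)/Ω_E) + μ(𝐇²(T)⁰)`**
— the conclusion of `Kato2004.rankZero_padicValNat_sha_add_padicValNat_tamagawa_le_of_additive_potGood_of_imageContainsSL2`
with `ImageContainsSL2` replaced by `E[p]` irreducible, up to the named defect (Readings I2, I4, count 1♭).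
[cite: Kato2004Asterisque, Thm. 12.5 (3) (p. 222), Thm. 14.5 (1)–(3) (p. 236), Prop. 14.16 (2) (p. 244)] -/
theorem padicValNat_sha_add_tamagawa_le_add_muInvariant (hR : TorsionFree.DescentCountReading IsOf)
    (hdiv : DivisibilityOffP IsOf) (hz : ZetaIndexNeZero IsOf)
    (hp : p ≠ 2) (hadd : Addv W p) (hj : 0 ≤ padicValRat p W.j) (hirr : Irr W p)
    (hL : W.entireLFunction 1 ≠ 0) (hfin : Finite W.sha) (D : KatoDescentDatum p)
    (hDof : IsOf W p D) :
    ∃ q : ℚ, W.entireLFunction 1 / (W.realPeriodRat : ℂ) = (q : ℂ) ∧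
      (padicValNat p (Nat.card (AddCommGroup.primaryComponent W.sha p)) : ℤ) +
          padicValNat p W.tamagawaProduct ≤ padicValRat p q + muInvariant p D.H2 := by
  have ht : ¬ p ∣ W.torsionOrder := Supersingular.not_dvd_torsionOrder_of_irr W p hirr
  obtain ⟨hfinH2, q, hq, hcount⟩ := hR W p D hp hadd hj ht hL hfin hDof
  have hne : D.zetaIndex ≠ 0 := hz W p D hp hadd hj hL hDof
  have hle : padicValNat p D.h2Card ≤ padicValNat p D.zetaIndex + muInvariant p D.H2 :=
    Kato2004.padicValNat_natCard_coinvariants_le_add_muInvariant_of_lengthAt_le_off_augIdealP D.z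
      D.z_ne_zero D.isTorsion_quotient D.isTorsion_H2 (hdiv W p D hp hadd hj hDof) D.ι D.π
      D.ι_injective D.π_surjective D.exact_ι_π hfinH2 hne
  refine ⟨q, hq, ?_⟩
  have hle' : (padicValNat p D.h2Card : ℤ) ≤ (padicValNat p D.zetaIndex : ℤ) + muInvariant p D.H2 := by
    exact_mod_cast hle
  linarith

end Descent

/-! ## §4 Where the defect lives: `μ(𝐇²(T)⁰) = 0` is Coates–Sujatha's Conjecture A, i.e. Iwasawa's
`μ`-conjecture for the `p`-division field `ℚ(E[p])` (hypothesis schema over an abstract predicate; nothing asserted)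

The `μ`-invariant of `𝐇²(T)⁰` vanishes iff `𝐇²(T)⁰` is finitely generated over `ℤ_p`
(`muInvariant_eq_zero_iff_holds`). By global duality `𝐇²(T) = lim H²(ℤ[ζ_{p^n},1/p],T)` surjects onto the
Pontryagin dual `Y(E)` of the fine Selmer group over `ℚ(ζ_{p^∞})` with kernel/local terms finitely generated
over `ℤ_p` (Wuthrich 2014 §4, p. 395: "By global duality it is dual to the kernel …"; the local terms are
`⊕_{v∣ℓ∈Σ} 𝐇²_v`, finitely many places above each `ℓ` in the cyclotomic tower, `E(ℚ_{p}(μ_{p^∞}))[p^∞]` finite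
at a potentially good `p`), so `μ(𝐇²(T)) = 0 ⟺ Y(E)` finitely generated over `ℤ_p` — Coates–Sujatha's
CONJECTURE A for `(E, p)` over `ℚ(μ_{p^∞})`. Coates–Sujatha, Math. Ann. 331 (2005) Thm. 3.4 (re-proved in
Lim–Murty, arXiv:1504.02522 §5: "Suppose that `F(A[p])` is a finite `p`-extension of `F`. Then Conjecture A
holds for `A` over `F_∞` if and only if the Iwasawa `μ`-invariant conjecture holds for `F_∞`"), applied
over the fixed field `F ⊇ ℚ(μ_p)` of a Sylow-`p`-subgroup of `Gal(ℚ(E[p])/ℚ)` (so that `ℚ(E[p])/F` is a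
`p`-extension and `[F : ℚ(μ_p)]` is prime to `p`, whence Conjecture A descends from `F_∞` to `ℚ(μ_{p^∞})`
and back by restriction–corestriction), together with Iwasawa's theorem that the `μ`-conjecture is
insensitive to finite `p`-extensions ([Iw], quoted loc. cit.), gives:
**Iwasawa's `μ`-invariant conjecture for the cyclotomic `ℤ_p`-extension of the number field `ℚ(E[p])` ⟹
`μ(𝐇²(T_pE)) = 0` ⟹ `μ(𝐇²(T_pE)⁰) = 0`.** Iwasawa's conjecture (1973) is a THEOREM for abelian number
fields (Ferrero–Washington 1979) — which is how Wuthrich's Lemma 14 gets `μ(Y(E)) = 0` from a rational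
`p`-isogeny (the characters of `E[p]` cut out abelian fields) — and OPEN otherwise; on the rows of the crux
`WildUpperNonsurjTower` (`p = 3`, `E[3]` irreducible, tower not surjective) the field `ℚ(E[3])` is Galois
over `ℚ` with group `N_ns(3) ≅ SD₁₆`, `N_s(3) ≅ D₄` or `GL₂(𝔽₃)` — non-abelian. The conjecture itself is
NOT typed here (an open problem is not a Literature fact): it enters as an ABSTRACT predicate `IwMu W p`
whose INTENDED BINDING is "the Galois group of the maximal abelian unramified pro-`p` extension of the
cyclotomic `ℤ_p`-extension of `ℚ(W[p])` is finitely generated over `ℤ_p`" (equivalently `ord_p h(ℚ(W[p])_n) =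
λn + ν` for `n ≫ 0`); `fun _ _ => True` is not a legitimate binding. -/

section ConjectureA

variable (IsOf : ∀ (W : WeierstrassCurve ℚ) [W.IsElliptic] [W.IsGloballyMinimal] (p : ℕ) [Fact p.Prime],
  KatoDescentDatum p → Prop)
variable (IwMu : ∀ (W : WeierstrassCurve ℚ) [W.IsElliptic] (p : ℕ), Prop)

/-- **READING I5 — Coates–Sujatha Thm. 3.4 with Kato's global duality: Iwasawa's `μ`-conjecture for
`ℚ(E[p])` ⟹ the defect vanishes.** For `W/ℚ` globally minimal, `p ≠ 2` additive potentially good and a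
realised datum `D` of `W`: if Iwasawa's `μ`-invariant conjecture holds for the cyclotomic `ℤ_p`-extension
of the `p`-division field `ℚ(W[p])` (abstract predicate `IwMu W p`, intended binding in the section
docstring), then `μ(𝐇²(T_pW)⁰) = 0` (`muInvariant p D.H2 = 0`) — Coates–Sujatha Thm. 3.4 over the
Sylow-`p` fixed field of `ℚ(W[p])/ℚ(μ_p)` + Iwasawa's invariance of the `μ`-conjecture under finite
`p`-extensions + restriction/corestriction along the prime-to-`p` layer + global duality
(`𝐇²(T) ↠ Y(E)` up to finitely generated local terms) + `μ = 0 ⟺` finitely generated over `ℤ_p`.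
Hypothesis schema over the interfaces `IsOf`, `IwMu`; NOTHING asserted (neither Conjecture A nor Iwasawa's
conjecture is claimed on any row). [cite: CoatesSujatha2005, Conjecture A and Thm. 3.4]
[cite: Wuthrich2014, §4 (p. 395) and proof of Lemma 14 (p. 396)] [cite: Washington1997, §13.2] -/
def ConjAReading : Prop :=
  ∀ (W : WeierstrassCurve ℚ) [W.IsElliptic] [W.IsGloballyMinimal] (p : ℕ) [Fact p.Prime]
    (D : KatoDescentDatum p),
    p ≠ 2 → Addv W p → 0 ≤ padicValRat p W.j → IwMu W p → IsOf W p D → muInvariant p D.H2 = 0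

variable {IsOf} {IwMu}

/-- **Iwasawa's `μ`-conjecture for `ℚ(E[p])` ⟹ the named defect predicate `H2MuZero`** (Reading I5, pointwise).
[cite: CoatesSujatha2005, Thm. 3.4] -/
theorem h2MuZero_of_iwMu (hA : ConjAReading IsOf IwMu) (W : WeierstrassCurve ℚ) [W.IsElliptic]
    [W.IsGloballyMinimal] (p : ℕ) [Fact p.Prime] (hp : p ≠ 2) (hadd : Addv W p)
    (hj : 0 ≤ padicValRat p W.j) (hμ : IwMu W p) : H2MuZero IsOf W p :=
  fun D hDof ↦ hA W p D hp hadd hj hμ hDof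

/-- **The upper half on a residually irreducible additive potentially good rank-`0` row from IWASAWA'S
`μ`-CONJECTURE FOR `ℚ(E[p])`** (`p ≠ 2`, any image) — over Readings I2–I5, part 8a's count 1♭, GZK and
modularity: `IwMu W p → MissingUpperBoundAt W p`. The crux `WildUpperNonsurjTower` of route
`KatoDescentPotSupersingular` is the case `p = 3` on its rows; Iwasawa's conjecture there concerns the
non-abelian fields `ℚ(E[3])` with group `SD₁₆`, `D₄` or `GL₂(𝔽₃)`. Conditional; nothing asserted.
[cite: CoatesSujatha2005, Thm. 3.4] [cite: Kato2004Asterisque, Thm. 12.5 (3) (p. 222), Thm. 14.5 (1)–(3) (p. 236)] -/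
theorem missingUpperBoundAt_of_iwMu (hR : TorsionFree.DescentCountReading IsOf)
    (hdiv : DivisibilityOffP IsOf) (hz : ZetaIndexNeZero IsOf) (hreal : Realizable IsOf)
    (hA : ConjAReading IsOf IwMu)
    (hGZK : rank_eq_analyticRank_of_analyticRank_le_one) (hmod : hasEntireLFunction_rat)
    (W : WeierstrassCurve ℚ) [W.IsElliptic] [W.IsGloballyMinimal] (p : ℕ) [Fact p.Prime]
    (hr : W.analyticRank = 0) (hp : p ≠ 2) (hadd : Addv W p) (hj : 0 ≤ padicValRat p W.j)
    (hirr : Irr W p) (hμ : IwMu W p) : MissingUpperBoundAt W p :=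
  missingUpperBoundAt_of_h2MuZero W p hR hdiv hz hreal hGZK hmod hr hp hadd hj hirr
    (h2MuZero_of_iwMu hA W p hp hadd hj hμ)

end ConjectureA

end Irreducible

end Summit.BirchSwinnertonDyer.Rank1Residual.Additive

end
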